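/-
PORT (pub-hodgecm2, COR-CM cell) of the stage-1 package file `HodgeCMPerL/HodgeCM/Proofs/PohlmannSpan.lean`
(pub-hodgecm HOME/lean, bytes of record md5 649662cd91b3, 362 lines). Declarations VERBATIM; edits: imports rewritten to tree
modules, namespace token `HodgeCM` ↦ `Summit.HodgeConjecture.CorCM`, package `conjRingHomK` ↦ tree `Literature.NumberTheory.Automorphic.cmConjRingHom`
(definitionally equal bodies), linter fixes. Generator: pub-hodgecm2-p1 `work/port/build_kit.py`.
b06 LANE VARIANT (theorems only): the three `def`s `Universe.sepOp`/`sepVal`/`permWeight` live VERBATIM in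
`Summits.HodgeConjecture.CorCM.Proofs.Pohlmann.SepOp` (imported); every other declaration byte-identical to the kit of record #32.
-/
import Summits.HodgeConjecture.CorCM.Proofs.Pohlmann.Descent
import Literature.NumberTheory.NumberFields.EmbeddingSeparation
import Summits.HodgeConjecture.CorCM.Proofs.Pohlmann.FactorAct
import Summits.HodgeConjecture.CorCM.Geometry.WeightFacts
import Summits.HodgeConjecture.CorCM.StubTree.Reduction
import Summits.HodgeConjecture.CorCM.Proofs.Pohlmann.SepOp

/-!
# Pohlmann's span theorem (product form): `PohlmannSpan` from the model facts

**Theorem** (`Summit.HodgeConjecture.CorCM.Universe.pohlmannSpan_holds`).  Under the model axioms M1–M28 and the two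
weight-space facts M29 (`Fact_weightSpan`) and M30 (`Fact_weightHodge`), `U.PohlmannSpan` holds: for a
Galois CM field `F` and `A′ = ∏_{j ≤ n} A_{(F,Θ_j)}`, every complexified Hodge class in `H^{2p}(A′)` lies
in the span of the weight vectors of HODGE weights.

Source followed: Gao–Ullmo, *J. Inst. Math. Jussieu* 25 (2025) = arXiv:2411.12249, Theorem 3.1
"(Pohlmann)" and its proof, p. 9 lines 32–48 (CM-algebra form: `B_ℂ = ⊕_{P ∈ T_B} V_P` with `T_B` stable
under `Aut(ℂ/ℚ)` and `[P]` of type `(p,p)`), itself after Pohlmann, *Ann. of Math.* 88 (1968) Thm 1.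

Proof implemented (the `Aut(ℂ/ℚ)`-action on coefficients of loc. cit. l. 44–47 is replaced by a
rational-operator / characteristic-polynomial argument, which Lean can express):
1. (`FactorAct`) for every factor `j` and `a ∈ 𝓞_F` a factor-wise CM multiplication `M_{j,a}` exists
   (M1, M18, M24); (`Separation`) finitely many pairs `(j_i, a_i)` and `c_i ∈ ℕ` make the eigencharacter
   `λ(S) = Σ_i c_i ∏_{s ∈ S_{j_i}} s(a_i)` injective in the weight `S`; put `T = Σ_i c_i M_i^*`, a
   RATIONAL endomorphism of `H^{2p}(A′, ℚ)` preserving the Hodge classes `B` (M3 `Fact_pull_hodge`).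
2. By M29 and independence of eigenspaces, the `λ(S)`-eigenspace of `T_ℂ` IS the weight space of `S`,
   and `H^{2p}(A′,ℂ) = ⊕_S` weight spaces; `B_ℂ` being `T_ℂ`-stable, `B_ℂ = ⊕_S (B_ℂ ∩ V_S)`
   (`Submodule.inf_iSup_genEigenspace`), so `B_ℂ ⊆ ⊕_{S ∈ T_B} V_S`, `T_B = {S | B_ℂ ∩ V_S ≠ 0}`.
3. `S ∈ T_B ⇒ [S]` has type `(p,p)`: `B_ℂ ⊆ H^{p,p}` and `V_S ⊆ H^{p_S,q_S}` (M30), distinct Hodge pieces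
   meet in `0`.
4. `T_B` is stable under the Galois translates `P`: `S ∈ T_B` iff `λ(S)` is a root of the RATIONAL
   polynomial `charpoly(T|_B)`; `λ(S) = σ₀(y_S)` with `y_S ∈ F` and `λ(P·S) = σ₀(g_P(y_S))` for the
   `g_P ∈ Gal(F/ℚ)` with `P(σ₀) = σ₀ ∘ g_P`; roots of a rational polynomial in `F` are `Gal`-stable.
5. Hence every `S ∈ T_B` is a Hodge weight (`|S| = p_S + q_S = 2p`, and `#{(j,s) : P s ∈ Θ_j} = p_{P·S}
   = p`), which is `PohlmannSpan`.
-/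

noncomputable section

open scoped TensorProduct NumberField
open Polynomial

namespace Summit.HodgeConjecture.CorCM

open Literature.AlgebraicGeometry.Motives (CMType HodgeStructure)
open Literature.AlgebraicGeometry.Motives.HodgeStructure (ofRat ofRat_apply)
open Summit.HodgeConjecture.CorCM.Pohlmann

namespace Universe

variable {U : Universe}

/-! ### The rational separating operator `T = Σ_i c_i M_i^*` and its eigencharacter -/

section SepOp

variable {ι : Type} [Fintype ι]

omit [Fintype ι] in
/-- Base change of a finite `ℚ`-linear combination of endomorphisms, evaluated: `(∑ qᵢ fᵢ)_ℂ x = ∑ qᵢ (fᵢ)_ℂ x`. -/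
theorem baseChange_sum_smul_apply {V : Type*} [AddCommGroup V] [Module ℚ V] (s : Finset ι)
    (q : ι → ℚ) (f : ι → V →ₗ[ℚ] V) (x : ℂ ⊗[ℚ] V) :
    (∑ i ∈ s, q i • f i).baseChange ℂ x = ∑ i ∈ s, (q i : ℂ) • (f i).baseChange ℂ x := by
  classical
  induction s using Finset.induction_on with
  | empty => simp
  | insert i s hi ih =>
    rw [Finset.sum_insert hi, Finset.sum_insert hi, LinearMap.baseChange_add, LinearMap.add_apply, ih,
      LinearMap.baseChange_smul, LinearMap.smul_apply, ← algebraMap_smul ℂ (q i), eq_ratCast]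

/-- The complexified separating operator `sepOp c Mi` acts as `∑ cᵢ · Mᵢ^*`. -/
theorem sepOp_baseChange_apply {X : U.Var} (c : ι → ℕ) (Mi : ι → U.Mor X X) (k : ℕ) (x : U.CohC X k) :
    (U.sepOp c Mi k).baseChange ℂ x = ∑ i, (c i : ℂ) • U.pullC (Mi i) k x := by
  unfold sepOp
  rw [baseChange_sum_smul_apply]
  simp only [Rat.cast_natCast]
  rfl

/-- `T` preserves the Hodge classes (M3 `Fact_pull_hodge`). -/
theorem sepOp_mem_hodgeClassesOf (M : U.ModelAxioms) {X : U.Var} (c : ι → ℕ) (Mi : ι → U.Mor X X)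
    (p : ℕ) {v : U.Coh X (2 * p)} (hv : v ∈ U.hodgeClassesOf X p) :
    U.sepOp c Mi (2 * p) v ∈ U.hodgeClassesOf X p := by
  unfold sepOp
  rw [LinearMap.sum_apply]
  exact Submodule.sum_mem _ fun i _ => by
    rw [LinearMap.smul_apply]
    exact Submodule.smul_mem _ _ (StubTree.pull_mem_hodgeClassesOf M.pull_hodge (Mi i) p hv)

end SepOp

/-! ### Weight spaces are the eigenspaces of `T_ℂ` -/

section Weights

variable {F : CMField} {n : ℕ} {Θ : Fin (n + 1) → CMType F} {ι : Type} [Fintype ι]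
  {j : ι → Fin (n + 1)} {a : ι → 𝓞 F} {c : ι → ℕ} {Mi : ι → U.Mor (U.cmProd F Θ) (U.cmProd F Θ)}

/-- A weight vector of weight `S` is a `λ(S)`-eigenvector of `T_ℂ`. -/
theorem weightSpace_le_eigenspace (hM : ∀ i, U.IsFactorAct F Θ (j i) (a i : F) (Mi i)) (k : ℕ)
    (S : Fin (n + 1) → Finset ((F : Type) →+* ℂ)) :
    U.weightSpace F Θ S k ≤
      Module.End.eigenspace ((U.sepOp c Mi k).baseChange ℂ) (sepVal j a c S) := by
  intro x hx
  rw [Module.End.mem_eigenspace_iff, sepOp_baseChange_apply, sepVal, Finset.sum_smul]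
  refine Finset.sum_congr rfl fun i _ => ?_
  rw [(U.mem_weightSpace_iff F Θ S k x).1 hx (j i) (a i : F) (Mi i) (hM i), smul_smul]

/-- The eigenspaces of `T_ℂ` exhaust `H^k(A′, ℂ)` (M29). -/
theorem iSup_eigenspace_eq_top (h29 : U.Fact_weightSpan)
    (hM : ∀ i, U.IsFactorAct F Θ (j i) (a i : F) (Mi i)) (k : ℕ) :
    ⨆ μ, Module.End.eigenspace ((U.sepOp c Mi k).baseChange ℂ) μ = ⊤ := by
  refine top_le_iff.mp ?_
  rw [← h29 F n Θ k]
  exact iSup_le fun S => le_iSup_of_le (sepVal j a c S) (weightSpace_le_eigenspace hM k S)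

/-- With `λ` injective, the `λ(S)`-eigenspace of `T_ℂ` is exactly the weight space of `S`. -/
theorem eigenspace_eq_weightSpace (h29 : U.Fact_weightSpan)
    (hM : ∀ i, U.IsFactorAct F Θ (j i) (a i : F) (Mi i)) (hinj : Function.Injective (sepVal j a c))
    (k : ℕ) (S : Fin (n + 1) → Finset ((F : Type) →+* ℂ)) :
    Module.End.eigenspace ((U.sepOp c Mi k).baseChange ℂ) (sepVal j a c S) = U.weightSpace F Θ S k :=
  eq_of_iSupIndep_of_iSup_eq_top (Module.End.eigenspaces_iSupIndep _) hinj
    (weightSpace_le_eigenspace hM k) (h29 F n Θ k) S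

/-- Every eigenvalue of `T_ℂ` is a `λ(S)`. -/
theorem exists_sepVal_eq (h29 : U.Fact_weightSpan)
    (hM : ∀ i, U.IsFactorAct F Θ (j i) (a i : F) (Mi i)) (k : ℕ) {μ : ℂ}
    (hμ : Module.End.eigenspace ((U.sepOp c Mi k).baseChange ℂ) μ ≠ ⊥) :
    ∃ S : Fin (n + 1) → Finset ((F : Type) →+* ℂ), sepVal j a c S = μ :=
  exists_of_iSupIndep_of_ne_bot (Module.End.eigenspaces_iSupIndep _) (sepVal j a c)
    (weightSpace_le_eigenspace hM k) (h29 F n Θ k) hμ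

/-! ### `B_ℂ ⊆ ⊕_{S ∈ T_B} V_S` -/

/-- The complexified Hodge classes lie in the sum of the weight spaces they meet. -/
theorem baseChange_hodgeClassesOf_le (M : U.ModelAxioms) (h29 : U.Fact_weightSpan)
    (hM : ∀ i, U.IsFactorAct F Θ (j i) (a i : F) (Mi i)) (hinj : Function.Injective (sepVal j a c))
    (p : ℕ) :
    (U.hodgeClassesOf (U.cmProd F Θ) p).baseChange ℂ ≤
      ⨆ (S : Fin (n + 1) → Finset ((F : Type) →+* ℂ))
        (_ : (U.hodgeClassesOf (U.cmProd F Θ) p).baseChange ℂ ⊓ U.weightSpace F Θ S (2 * p) ≠ ⊥),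
        U.weightSpace F Θ S (2 * p) := by
  set B := U.hodgeClassesOf (U.cmProd F Θ) p
  set T := U.sepOp c Mi (2 * p)
  have hB : ∀ v ∈ B, T v ∈ B := fun v hv => sepOp_mem_hodgeClassesOf M c Mi p hv
  have hBC : ∀ x ∈ B.baseChange ℂ, T.baseChange ℂ x ∈ B.baseChange ℂ :=
    fun x hx => baseChange_mem_baseChange_of_mem T hB hx
  have hdec : B.baseChange ℂ = ⨆ μ, B.baseChange ℂ ⊓ Module.End.eigenspace (T.baseChange ℂ) μ := by
    have h := Submodule.inf_iSup_genEigenspace (p := B.baseChange ℂ) (f := T.baseChange ℂ) hBC 1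
    rw [iSup_eigenspace_eq_top h29 hM (2 * p), inf_top_eq] at h
    exact h
  refine hdec.le.trans (iSup_le fun μ => ?_)
  by_cases hμ : B.baseChange ℂ ⊓ Module.End.eigenspace (T.baseChange ℂ) μ = ⊥
  · rw [hμ]; exact bot_le
  have hμ' : Module.End.eigenspace (T.baseChange ℂ) μ ≠ ⊥ :=
    fun h => hμ (eq_bot_iff.mpr (inf_le_right.trans h.le))
  obtain ⟨S, rfl⟩ := exists_sepVal_eq h29 hM (2 * p) hμ'
  rw [eigenspace_eq_weightSpace h29 hM hinj (2 * p) S] at hμ ⊢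
  exact le_iSup₂_of_le S hμ inf_le_right

/-! ### `S ∈ T_B ⇒ [S]` has type `(p,p)` -/

/-- A weight met by the Hodge classes has `p_S = q_S = p` (M30 and `B_ℂ ⊆ H^{p,p}`). -/
theorem types_of_meets (h30 : U.Fact_weightHodge) (p : ℕ) {S : Fin (n + 1) → Finset ((F : Type) →+* ℂ)}
    (hS : (U.hodgeClassesOf (U.cmProd F Θ) p).baseChange ℂ ⊓ U.weightSpace F Θ S (2 * p) ≠ ⊥) :
    (∑ j, ∑ s ∈ S j, ind (Θ j) s) = p ∧ (∑ j, ∑ s ∈ S j, (1 - ind (Θ j) s)) = p := by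
  obtain ⟨x, hx, hx0⟩ := (Submodule.ne_bot_iff _).mp hS
  obtain ⟨hxB, hxS⟩ := Submodule.mem_inf.mp hx
  have hn : (p : ℤ) + p = ((2 * p : ℕ) : ℤ) := by push_cast; ring
  have h1 : x ∈ (U.hodge (U.cmProd F Θ) (2 * p)).piece p p :=
    baseChange_hodgeClasses_le_piece (U.hodge (U.cmProd F Θ) (2 * p)) hn hxB
  have h2 := h30 F n Θ (2 * p) S hxS
  by_contra hne
  rw [← Prod.mk.injEq, ← Ne] at hne
  have hne' : ((∑ j, ∑ s ∈ S j, ind (Θ j) s), (∑ j, ∑ s ∈ S j, (1 - ind (Θ j) s))) ≠ ((p : ℤ), (p : ℤ)) :=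
    fun h => hne (by rw [Prod.mk.injEq] at h ⊢; exact h)
  have hbot := piece_inf_piece_eq_bot (U.hodge (U.cmProd F Θ) (2 * p)) hn hne'
  exact hx0 ((Submodule.mem_bot ℂ).mp (hbot ▸ Submodule.mem_inf.mpr ⟨h2, h1⟩))

end Weights

/-! ### Galois translates of weights -/

section Galois

variable {F : CMField} {n : ℕ}

/-- Re-indexing a double sum over the permuted weight `permWeight P S` by the permutation `P`. -/
theorem sum_sum_permWeight {β : Type*} [AddCommMonoid β] (P : Equiv.Perm ((F : Type) →+* ℂ))
    (S : Fin (n + 1) → Finset ((F : Type) →+* ℂ)) (f : Fin (n + 1) → ((F : Type) →+* ℂ) → β) :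
    (∑ j, ∑ t ∈ permWeight P S j, f j t) = ∑ j, ∑ s ∈ S j, f j (P s) := by
  refine Finset.sum_congr rfl fun j _ => ?_
  rw [permWeight, Finset.sum_map]
  rfl

/-- Re-indexing a product over `permWeight P S j` by the permutation `P`. -/
theorem prod_permWeight {β : Type*} [CommMonoid β] (P : Equiv.Perm ((F : Type) →+* ℂ))
    (S : Fin (n + 1) → Finset ((F : Type) →+* ℂ)) (j : Fin (n + 1)) (f : ((F : Type) →+* ℂ) → β) :
    (∏ t ∈ permWeight P S j, f t) = ∏ s ∈ S j, f (P s) := by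
  rw [permWeight, Finset.prod_map]
  rfl

/-- Permuting a weight preserves its total size `∑ⱼ |Sⱼ|`. -/
theorem sum_card_permWeight (P : Equiv.Perm ((F : Type) →+* ℂ))
    (S : Fin (n + 1) → Finset ((F : Type) →+* ℂ)) :
    (∑ j, (permWeight P S j).card) = ∑ j, (S j).card := by
  refine Finset.sum_congr rfl fun j _ => ?_
  rw [permWeight, Finset.card_map]

variable [IsGalois ℚ F] {ι : Type} [Fintype ι]

/-- `λ(S) = σ₀(y_S)` with `y_S ∈ F`, and `λ(P • S) = σ₀(g_P(y_S))` whenever `P(σ₀) = σ₀ ∘ g_P`. -/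
theorem exists_sepVal_eq_emb (σ₀ : (F : Type) →+* ℂ) (j : ι → Fin (n + 1)) (a : ι → 𝓞 F) (c : ι → ℕ)
    (S : Fin (n + 1) → Finset ((F : Type) →+* ℂ)) :
    ∃ y : F, sepVal j a c S = σ₀ y ∧
      ∀ (P : GalT F) (g : (F : Type) ≃ₐ[ℚ] F), P.1 σ₀ = σ₀.comp (g : (F : Type) →+* F) →
        sepVal j a c (permWeight P.1 S) = σ₀ (g y) := by
  -- `s = σ₀ ∘ g_s`
  have hs : ∀ s : (F : Type) →+* ℂ, s = σ₀.comp ((embOfAut σ₀).symm s : (F : Type) →+* F) := fun s => by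
    rw [← embOfAut_apply, Equiv.apply_symm_apply]
  refine ⟨∑ i, (c i : F) * ∏ s ∈ S (j i), (embOfAut σ₀).symm s (a i : F), ?_, fun P g hP => ?_⟩
  · simp only [sepVal, map_sum, map_mul, map_natCast, map_prod]
    refine Finset.sum_congr rfl fun i _ => ?_
    congr 1
    refine Finset.prod_congr rfl fun s _ => ?_
    conv_lhs => rw [hs s]
    simp
  · simp only [sepVal, map_sum, map_mul, map_natCast, map_prod, prod_permWeight]
    refine Finset.sum_congr rfl fun i _ => ?_
    congr 1
    refine Finset.prod_congr rfl fun s _ => ?_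
    conv_lhs => rw [hs s]
    rw [GalT.apply_comp, hP]
    simp

omit [IsGalois ℚ F] [Fintype ι] in
/-- Roots in `F` of a rational polynomial are permuted by `Gal(F/ℚ)` (read through `σ₀ : F → ℂ`). -/
theorem isRoot_map_emb_of_isRoot (χ : ℚ[X]) (σ₀ : (F : Type) →+* ℂ) (g : (F : Type) ≃ₐ[ℚ] F) {y : F}
    (h : (χ.map (algebraMap ℚ ℂ)).IsRoot (σ₀ y)) : (χ.map (algebraMap ℚ ℂ)).IsRoot (σ₀ (g y)) := by
  rw [IsRoot.def, eval_map] at h ⊢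
  have e1 : algebraMap ℚ ℂ = σ₀.comp (algebraMap ℚ F) := Subsingleton.elim _ _
  have e2 : algebraMap ℚ (F : Type) = (g : (F : Type) →+* F).comp (algebraMap ℚ F) := Subsingleton.elim _ _
  rw [e1, ← hom_eval₂, map_eq_zero_iff _ σ₀.injective] at h ⊢
  have h' : χ.eval₂ (algebraMap ℚ (F : Type)) (g y) = g (χ.eval₂ (algebraMap ℚ (F : Type)) y) := by
    conv_lhs => rw [e2]
    rw [← RingHom.coe_coe g, ← hom_eval₂]
  rw [h', h, map_zero]

end Galois

/-! ### `T_B` is Galois-stable; assembly -/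

section Assembly

variable {F : CMField} [IsGalois ℚ F] {n : ℕ} {Θ : Fin (n + 1) → CMType F} {ι : Type} [Fintype ι]
  {j : ι → Fin (n + 1)} {a : ι → 𝓞 F} {c : ι → ℕ} {Mi : ι → U.Mor (U.cmProd F Θ) (U.cmProd F Θ)}

omit [IsGalois ℚ F] in
/-- `S ∈ T_B` iff `λ(S)` is a root of the (rational!) characteristic polynomial of `T|_B`. -/
theorem meets_iff_isRoot (M : U.ModelAxioms) (h29 : U.Fact_weightSpan)
    (hM : ∀ i, U.IsFactorAct F Θ (j i) (a i : F) (Mi i)) (hinj : Function.Injective (sepVal j a c))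
    (p : ℕ) (S : Fin (n + 1) → Finset ((F : Type) →+* ℂ)) :
    (U.hodgeClassesOf (U.cmProd F Θ) p).baseChange ℂ ⊓ U.weightSpace F Θ S (2 * p) ≠ ⊥ ↔
      (((U.sepOp c Mi (2 * p)).restrict
          (fun _ hv => sepOp_mem_hodgeClassesOf M c Mi p hv)).charpoly.map (algebraMap ℚ ℂ)).IsRoot
        (sepVal j a c S) := by
  rw [← exists_eigenvector_mem_baseChange_iff, Submodule.ne_bot_iff]
  constructor
  · rintro ⟨x, hx, hx0⟩
    obtain ⟨hxB, hxS⟩ := Submodule.mem_inf.mp hx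
    refine ⟨x, hxB, hx0, ?_⟩
    rw [← Module.End.mem_eigenspace_iff]
    exact weightSpace_le_eigenspace hM (2 * p) S hxS
  · rintro ⟨x, hxB, hx0, hx⟩
    refine ⟨x, Submodule.mem_inf.mpr ⟨hxB, ?_⟩, hx0⟩
    rw [← eigenspace_eq_weightSpace h29 hM hinj (2 * p) S, Module.End.mem_eigenspace_iff]
    exact hx

/-- `T_B` is stable under Galois translates. -/
theorem meets_permWeight (M : U.ModelAxioms) (h29 : U.Fact_weightSpan)
    (hM : ∀ i, U.IsFactorAct F Θ (j i) (a i : F) (Mi i)) (hinj : Function.Injective (sepVal j a c))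
    (p : ℕ) {S : Fin (n + 1) → Finset ((F : Type) →+* ℂ)}
    (hS : (U.hodgeClassesOf (U.cmProd F Θ) p).baseChange ℂ ⊓ U.weightSpace F Θ S (2 * p) ≠ ⊥)
    (P : GalT F) :
    (U.hodgeClassesOf (U.cmProd F Θ) p).baseChange ℂ ⊓ U.weightSpace F Θ (permWeight P.1 S) (2 * p) ≠ ⊥ := by
  -- an embedding `σ₀` exists
  obtain ⟨σ₀⟩ : Nonempty ((F : Type) →+* ℂ) := by
    have hc : 0 < Fintype.card ((F : Type) →+* ℂ) := by
      rw [NumberField.Embeddings.card]; exact Module.finrank_pos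
    exact Fintype.card_pos_iff.mp hc
  obtain ⟨y, hy, hPy⟩ := exists_sepVal_eq_emb σ₀ j a c S
  obtain ⟨g, hg⟩ := exists_aut_eq σ₀ (P.1 σ₀)
  rw [meets_iff_isRoot M h29 hM hinj p] at hS ⊢
  rw [hPy P g hg]
  rw [hy] at hS
  exact isRoot_map_emb_of_isRoot _ σ₀ g hS

/-- Every weight met by the Hodge classes is a Hodge weight. -/
theorem isHodgeWeight_of_meets (M : U.ModelAxioms) (h29 : U.Fact_weightSpan) (h30 : U.Fact_weightHodge)
    (hM : ∀ i, U.IsFactorAct F Θ (j i) (a i : F) (Mi i)) (hinj : Function.Injective (sepVal j a c))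
    (p : ℕ) {S : Fin (n + 1) → Finset ((F : Type) →+* ℂ)}
    (hS : (U.hodgeClassesOf (U.cmProd F Θ) p).baseChange ℂ ⊓ U.weightSpace F Θ S (2 * p) ≠ ⊥) :
    IsHodgeWeight Θ p S := by
  refine ⟨?_, fun P => ?_⟩
  · obtain ⟨hp, hq⟩ := types_of_meets h30 p hS
    have hsum : (∑ j, ∑ s ∈ S j, ind (Θ j) s) + (∑ j, ∑ s ∈ S j, (1 - ind (Θ j) s)) =
        ((∑ j, (S j).card : ℕ) : ℤ) := by
      rw [← Finset.sum_add_distrib, Nat.cast_sum]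
      refine Finset.sum_congr rfl fun j _ => ?_
      rw [← Finset.sum_add_distrib, Finset.sum_congr rfl fun s _ => add_sub_cancel (ind (Θ j) s) 1]
      simp
    rw [hp, hq] at hsum
    have : ((∑ j, (S j).card : ℕ) : ℤ) = ((2 * p : ℕ) : ℤ) := by rw [← hsum]; push_cast; ring
    exact_mod_cast this
  · rw [← sum_sum_permWeight P.1 S fun j t => ind (Θ j) t]
    exact (types_of_meets h30 p (meets_permWeight M h29 hM hinj p hS P)).1

end Assembly

/-! ### The theorem -/

/-- **Pohlmann's span theorem, product form** ([Gao–Ullmo 2025, Thm 3.1 (Pohlmann)]; Pohlmann 1968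
Thm 1; [QW8] L2.2): under the model axioms and the weight-space facts M29/M30, `U.PohlmannSpan`. -/
theorem pohlmannSpan_holds (M : U.ModelAxioms) (h29 : U.Fact_weightSpan) (h30 : U.Fact_weightHodge) :
    U.PohlmannSpan := by
  intro F hG _h6 n Θ p
  -- separating family and factor-wise multiplications
  obtain ⟨j, a, c, hinj⟩ := Literature.NumberTheory.NumberFields.exists_separating_weight_functional (F := (F : Type)) n
  choose Mi hMi using fun i => exists_isFactorAct M F Θ (j i) (a i)
  have hinj' : Function.Injective (sepVal j a c) := hinj
  -- `B_ℂ ⊆ ⊕_{S ∈ T_B} V_S ⊆ span {weight vectors of Hodge weights}`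
  rw [Submodule.map_le_iff_le_comap]
  intro b hb
  rw [Submodule.mem_comap, Submodule.restrictScalars_mem]
  have hbC : ofRat b ∈ (U.hodgeClassesOf (U.cmProd F Θ) p).baseChange ℂ :=
    Submodule.tmul_mem_baseChange_of_mem 1 hb
  refine (baseChange_hodgeClassesOf_le M h29 hMi hinj' p).trans ?_ hbC
  refine iSup₂_le fun S hS => ?_
  intro x hx
  exact Submodule.subset_span ⟨S, isHodgeWeight_of_meets M h29 h30 hMi hinj' p hS,
    (U.mem_weightSpace_iff F Θ S (2 * p) x).1 hx⟩

end Universe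

end Summit.HodgeConjecture.CorCM

end
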